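import Literature.Computability.MetaComplexity.BoundedArithS2Seq
import Literature.Computability.Complexity.TM2ArithCode
import Mathlib.Algebra.Polynomial.Degree.Defs
import HarnessLib

/-!
# The computation of a polynomial-time `TM2` machine as a `Σᵇ₁` definition of `S₂¹`

Topic `Literature/Computability/Complexity`.  For a bundled multi-stack machine `tm : FinTM2`
(Mathlib) with Boolean input/output alphabets and a polynomial time bound `p`, we write down —
with the uniform `Σᵇ₁` definitions `GDef` of `BoundedArithS2Graphs.lean` / `BoundedArithS2Seq.lean` —
the function "output of the computation on input `x` padded to `|ℓ(x)| ≥ p(|x|)` steps"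
(Buss 1986, Ch. 3: every polynomial-time function is `Σᵇ₁`-definable in `S₂¹`; Krajíček 1995,
§6.1, Lemma 6.1.1: `Comp_M(x, w)` by limited recursion on notation), mirroring symbol by symbol
the arithmetic coding of `TM2ArithCode.lean`:

* bounding terms: `timeTerm p` (`|timeTerm p (x)| > p(|x|)`), the field width `widthTerm`
  (`W = |ω(x)|`), the block width `blockTerm` (`B = |β(x)| ≥ (nStk + 2)·W`);
* `fieldG`, `keyG`, `applyG κ`, **`stepG`** (definition by cases on the key over all
  `κ < 2^keyWidth`, default `0`) — the `Σᵇ₁` counterpart of `TM2Arith.stepCode`;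
* `parityG`, `bitG`, `inDigitG`, `inputStackG`, **`initG`** — the code of the initial configuration
  on input `x` (input stack = the bits of `x`, `Computability.encodeNat`);
* `outDigitG`, **`outG`** — the number whose bits are read off the output stack;
* **`machineG`** `= outG ∘ iterate initG stepG ℓ β : GDef 1` and its goodness `good_machineG`:
  the graph is `Σᵇ₁` and total and functional in every model of `BASIC + Σᵇ₁-PIND`.

Only goodness is proved here (it is structural); the evaluation in `ℕ` (the value is the
function computed by the machine) is in the sibling file proving
`isSigmabDefinable_S2_one_of_polyTimeComputable`.

## References

* S. R. Buss, *Bounded Arithmetic*, Bibliopolis 1986, Ch. 3 (Thm.: every `□ᵖ₁` function is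
  `Σᵇ₁`-definable in `S₂¹`), §2.6 (limited iteration).
* J. Krajíček, *Bounded Arithmetic, Propositional Logic and Complexity Theory*, CUP 1995, §6.1,
  Lemma 6.1.1 (p. 86).
-/

namespace Literature.Computability.Complexity

open FirstOrder FirstOrder.Language MetaComplexity MetaComplexity.GDef TM2Arith Turing

namespace S2Machine

/-! ## Bounding terms -/

/-- `(2x + 1) # (2x + 1) # ⋯` : `smashPow D` has length `≥ (|x| + 1)^D` (`D`-fold smash of `2x+1`,
whose length is `|x| + 1`). [cite: Buss1986, §2.4] -/
def smashPow : ℕ → Language.boundedArith.Term (Fin 1)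
  | 0 => natConst 1
  | D + 1 => Term.smash (smashPow D) (Term.succ (natConst 2 * Term.var 0))

/-- **The time term of a polynomial** `p`: `2^C # smashPow (deg p)` with `C` the sum of the
coefficients, so that `|timeTerm p (x)| > p(|x|)` (Buss 1986, §2.4: every polynomial in `|x|` is
dominated by the length of a term). [cite: Buss1986, §2.4] -/
noncomputable def timeTerm (p : Polynomial ℕ) : Language.boundedArith.Term (Fin 1) :=
  Term.smash (natConst (2 ^ (p.support.sum fun i => p.coeff i))) (smashPow p.natDegree)

variable (tm : FinTM2)

/-- The constant `C₁ = wl + ws + b·(d+1) + 1` of the width term. [folklore] -/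
noncomputable def widthConst : ℕ := labWidth tm + stWidth tm + symWidth tm * (TM2Sim.depth tm + 1) + 1

/-- **The field-width term** `ω(x) = 2^{C₁} # ((2x+1) # (2ℓ(x)+1))`: `W = |ω(x)|` exceeds the label
and state widths and `b·(|x| + |ℓ(x)|·d + d)` (room for every stack during `|ℓ(x)|` steps).
[cite: Krajicek1995, Lemma 6.1.1 (p. 86)] -/
noncomputable def widthTerm (ℓ : Language.boundedArith.Term (Fin 1)) : Language.boundedArith.Term (Fin 1) :=
  Term.smash (natConst (2 ^ widthConst tm))
    (Term.smash (Term.succ (natConst 2 * Term.var 0)) (Term.succ (natConst 2 * ℓ)))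

/-- **The block-width term** `β(x) = 2^{nStk+2} # ω(x)`: `B = |β(x)| ≥ (nStk + 2)·W`, room for a whole
configuration code. [cite: Krajicek1995, Lemma 6.1.1 (p. 86)] -/
noncomputable def blockTerm (ℓ : Language.boundedArith.Term (Fin 1)) : Language.boundedArith.Term (Fin 1) :=
  Term.smash (natConst (2 ^ (nStk tm + 2))) (widthTerm tm ℓ)

variable (ℓ : Language.boundedArith.Term (Fin 1))

/-- The size parameter term `S(x) = sizeT ℓ β` weakened to a context `Fin (1 + m)`… (we use explicit
relabelling at each use). [folklore] -/
noncomputable def sizeTerm : Language.boundedArith.Term (Fin 1) := sizeT ℓ (blockTerm tm ℓ)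

/-! ## The step: fields, key, response, selection (context `(x, j, c)`) -/

section Step

/-- The size parameter in the context `(x, j, c)`. [folklore] -/
noncomputable def S3 : Language.boundedArith.Term (Fin 3) := (sizeTerm tm ℓ).relabel ![0]

/-- The field width `W` as a term in the context `(x, j, c)`. [folklore] -/
noncomputable def W3 : Language.boundedArith.Term (Fin 3) := Term.len ((widthTerm tm ℓ).relabel ![0])

/-- **Field `i` of the configuration code `c`**: `blk(S, c, i, W)`. [cite: Krajicek1995, §6.1 (p. 86)] -/
noncomputable def fieldG (i : ℕ) : GDef 3 :=
  substArgs ![S3 tm ℓ, Term.var 2, natConst i, W3 tm ℓ] blkG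

/-- `lsp(S, F(x,j,c), m)` for a definition `F` and a numeral `m`. [folklore] -/
noncomputable def lspConstG (F : GDef 3) (m : ℕ) : GDef 3 :=
  substLast (substArgs ![(S3 tm ℓ).relabel Fin.castSucc, Term.var 3, natConst m] lspG) F

/-- `msp(S, F(x,j,c), m)` for a definition `F` and a numeral `m`. [folklore] -/
noncomputable def mspConstG (F : GDef 3) (m : ℕ) : GDef 3 :=
  substLast (substArgs ![(S3 tm ℓ).relabel Fin.castSucc, Term.var 3, natConst m] mspG) F

/-- `lsp(S, F(x,j,c), W)`: truncation to the field width. [folklore] -/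
noncomputable def lspWG (F : GDef 3) : GDef 3 :=
  substLast (substArgs ![(S3 tm ℓ).relabel Fin.castSucc, Term.var 3, (W3 tm ℓ).relabel Fin.castSucc] lspG) F

/-- `2^(i·W)` (as `pw S (i·W)`) in the context `(x, j, c)`. [folklore] -/
noncomputable def pwWG (i : ℕ) : GDef 3 :=
  substArgs ![S3 tm ℓ, natConst i * W3 tm ℓ] pwG

/-- The visible top segment of stack `i`: `field(i+2) mod 2^(b·d)`. [cite: Krajicek1995, §6.1 (p. 86)] -/
noncomputable def topG (i : Fin (nStk tm)) : GDef 3 :=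
  lspConstG tm ℓ (fieldG tm ℓ (i + 2)) (symWidth tm * TM2Sim.depth tm)

/-- **The key read off the code**: `field 0 + 2^wl·(field 1 + 2^ws·Σᵢ topᵢ·2^(i·b·d))`
(`TM2Arith.codeKey`). [cite: Krajicek1995, §6.1 (p. 86)] -/
noncomputable def keyG : GDef 3 :=
  addG (fieldG tm ℓ 0)
    (mulG (num 3 (2 ^ labWidth tm))
      (addG (fieldG tm ℓ 1)
        (mulG (num 3 (2 ^ stWidth tm))
          (sumG (List.ofFn fun i : Fin (nStk tm) =>
            mulG (topG tm ℓ i) (num 3 (2 ^ (symWidth tm * TM2Sim.depth tm * i))))))))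

/-- The new field of stack `i` for the key `κ`: `(respSeg κ i + 2^(b·respLen κ i)·(field(i+2) / 2^(b·d))) mod 2ᵂ`
(`TM2Arith.newStkField`). [cite: Krajicek1995, §6.1 (p. 86)] -/
noncomputable def newStkG (κ : ℕ) (i : Fin (nStk tm)) : GDef 3 :=
  lspWG tm ℓ
    (addG (num 3 (respSeg tm κ i))
      (mulG (num 3 (2 ^ (symWidth tm * respLen tm κ i)))
        (mspConstG tm ℓ (fieldG tm ℓ (i + 2)) (symWidth tm * TM2Sim.depth tm))))

/-- **The response for the key `κ` applied to the code**: `respLab κ + respSt κ·2ᵂ + Σᵢ newStkᵢ·2^((i+2)W)`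
(`TM2Arith.stepCode` at key `κ`). [cite: Krajicek1995, §6.1 (p. 86)] -/
noncomputable def applyG (κ : ℕ) : GDef 3 :=
  sumG ([num 3 (respLab tm κ), mulG (num 3 (respSt tm κ)) (pwWG tm ℓ 1)] ++
    List.ofFn fun i : Fin (nStk tm) => mulG (newStkG tm ℓ κ i) (pwWG tm ℓ (i + 2)))

/-- **The step** `G(x, j, c)`: by cases on the key over all `κ < 2^keyWidth` (default `0`)
(Krajíček 1995, §6.1, `Consec_M`; Buss 1986, Ch. 3). [cite: Krajicek1995, Lemma 6.1.1 (p. 86)] -/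
noncomputable def stepG : GDef 3 :=
  select (keyG tm ℓ) ((List.range (2 ^ keyWidth tm)).map fun κ => (κ, applyG tm ℓ κ)) (num 3 0)

variable {tm ℓ}

/-- `fieldG` is good. [folklore] -/
theorem good_fieldG (i : ℕ) : (fieldG tm ℓ i).Good := good_blkG.substArgs _

/-- `lspConstG` is good. [folklore] -/
theorem good_lspConstG {F : GDef 3} (hF : F.Good) (m : ℕ) : (lspConstG tm ℓ F m).Good :=
  (good_lspG.substArgs _).substLast hF

/-- `mspConstG` is good. [folklore] -/
theorem good_mspConstG {F : GDef 3} (hF : F.Good) (m : ℕ) : (mspConstG tm ℓ F m).Good :=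
  (good_mspG.substArgs _).substLast hF

/-- `lspWG` is good. [folklore] -/
theorem good_lspWG {F : GDef 3} (hF : F.Good) : (lspWG tm ℓ F).Good :=
  (good_lspG.substArgs _).substLast hF

/-- `pwWG` is good. [folklore] -/
theorem good_pwWG (i : ℕ) : (pwWG tm ℓ i).Good := good_pwG.substArgs _

/-- `topG` is good. [folklore] -/
theorem good_topG (i : Fin (nStk tm)) : (topG tm ℓ i).Good := good_lspConstG (good_fieldG _) _

/-- `keyG` is good. [folklore] -/
theorem good_keyG : (keyG tm ℓ).Good := by
  refine (good_fieldG 0).addG ((good_num _ _).mulG ((good_fieldG 1).addG ((good_num _ _).mulG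
    (good_sumG fun F hF => ?_))))
  obtain ⟨i, rfl⟩ := (List.mem_ofFn' _ _).1 hF
  exact (good_topG i).mulG (good_num _ _)

/-- `newStkG` is good. [folklore] -/
theorem good_newStkG (κ : ℕ) (i : Fin (nStk tm)) : (newStkG tm ℓ κ i).Good :=
  good_lspWG ((good_num _ _).addG ((good_num _ _).mulG (good_mspConstG (good_fieldG _) _)))

/-- `applyG` is good. [folklore] -/
theorem good_applyG (κ : ℕ) : (applyG tm ℓ κ).Good := by
  refine good_sumG fun F hF => ?_
  simp only [List.cons_append, List.nil_append, List.mem_cons, List.mem_ofFn] at hF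
  rcases hF with rfl | rfl | ⟨i, rfl⟩
  · exact good_num _ _
  · exact (good_num _ _).mulG (good_pwWG _)
  · exact (good_newStkG κ i).mulG (good_pwWG _)

/-- **`stepG` is good.** [cite: Krajicek1995, Lemma 6.1.1 (p. 86)] -/
theorem good_stepG : (stepG tm ℓ).Good := by
  refine good_select good_keyG (fun p hp => ?_) (good_num _ _) ?_
  · obtain ⟨κ, -, rfl⟩ := List.mem_map.1 hp
    exact good_applyG κ
  · rw [List.map_map]
    simpa [Function.comp_def] using List.nodup_range

end Step

/-! ## The initial configuration (context `(x)` and `(x, i)`) -/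

section Init

/-- **`parityG`**: `parity y = y mod 2` on `(y)` — graph `(2⌊y/2⌋ = y ∧ e = 0) ∨ (2⌊y/2⌋ ≠ y ∧ e = 1)`
(`BASICModel.eq_parity_iff`). [cite: Buss1986, §2.4] -/
noncomputable def parityG : GDef 1 where
  graph := SForm.or
    (SForm.and (SForm.eq (natConst 2 * Term.half (Term.var 0)) (Term.var 0)) (SForm.eq (Term.var 1) 0))
    (SForm.and (SForm.ne (natConst 2 * Term.half (Term.var 0)) (Term.var 0))
      (SForm.eq (Term.var 1) (natConst 1)))
  bound := natConst 1

/-- Semantics of `parityG`. [folklore] -/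
theorem rel_parityG {M : Type} [Language.boundedArith.Structure M] [M ⊨ BASIC] {x : Fin 1 → M} {e : M} :
    parityG.Rel x e ↔ e = BASICModel.parity (x 0) := by
  rw [BASICModel.eq_parity_iff]
  simp only [parityG, GDef.Rel, SForm.realize_or, SForm.realize_and, SForm.realize_eq, SForm.realize_ne,
    realize_term_mul, realize_term_half, Term.realize_var, GDef.realize_natConst_cast, Nat.cast_ofNat,
    Nat.cast_one, snoc_fin_one_zero, snoc_fin_one_one, BASICModel.mMul_eq, realize_term_zero,
    BASICModel.mZero_eq]

/-- **`parityG` is good.** [cite: Buss1986, §2.4] -/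
theorem good_parityG : parityG.Good where
  sig := rfl
  isFn M _ _ _ :=
    { total := fun x => ⟨_, rel_parityG.2 rfl⟩
      unique := fun x y y' hy hy' => (rel_parityG.1 hy).trans (rel_parityG.1 hy').symm
      le_bound := fun x y hy => by
        rw [rel_parityG.1 hy]
        simpa [parityG, GDef.realize_natConst_cast] using
          (BASICModel.mLe_iff _ _).2 (BASICModel.parity_le_one (x 0)) }

/-- The value of `parityG`. [folklore] -/
theorem fn_parityG {M : Type} [Language.boundedArith.Structure M] [M ⊨ BASIC]
    [M ⊨ PINDScheme (sigmabFormulas 1)] (x : Fin 1 → M) : parityG.fn x = BASICModel.parity (x 0) :=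
  good_parityG.isFnIn.fn_eq_of_rel (rel_parityG.2 rfl)

variable (tm : FinTM2) (ℓ : Language.boundedArith.Term (Fin 1))

/-- The size parameter of the input-stack comprehension (count `|x|`, width `b`). [folklore] -/
noncomputable def inBeta : Language.boundedArith.Term (Fin 1) := natConst (2 ^ symWidth tm / 2)

/-- **`bitG`**: the bit `i` of `x`, `parity(msp(Sᵢₙ, x, i))`, on `(x, i)`. [cite: Buss1986, §2.5] -/
noncomputable def bitG : GDef 2 :=
  substLast (substArgs ![Term.var 2] parityG)
    (substArgs ![(sizeT (Term.var 0) (inBeta tm)).relabel ![0], Term.var 0, Term.var 1] mspG)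

variable (cfalse ctrue : ℕ)

/-- **The input digit** `i` of `x`: the code of the input symbol carrying bit `i` of `x`
(`ctrue` if the bit is `1`, `cfalse` if it is `0`), on `(x, i)`. [cite: Krajicek1995, §6.1 (p. 86)] -/
noncomputable def inDigitG : GDef 2 :=
  select (bitG tm) [(0, num 2 cfalse), (1, num 2 ctrue)] (num 2 0)

/-- **The input stack code**: the comprehension of the input digits below `|x|`, width `b`.
[cite: Krajicek1995, §6.1 (p. 86)] -/
noncomputable def inputStackG : GDef 1 := collect (inDigitG tm cfalse ctrue) (Term.var 0) (inBeta tm)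

/-- `2^(i·W)` in the context `(x)`. [folklore] -/
noncomputable def pwW1 (i : ℕ) : GDef 1 :=
  substArgs ![sizeTerm tm ℓ, natConst i * Term.len (widthTerm tm ℓ)] pwG

variable (lab0 st0 kin : ℕ)

/-- **The code of the initial configuration**: `lab₀ + st₀·2ᵂ + inputStack·2^((kᵢₙ+2)·W)` (fields:
initial label and state, the input stack at the index of `k₀`, all other stacks empty).
[cite: Krajicek1995, §6.1 (p. 86)] -/
noncomputable def initG : GDef 1 :=
  sumG [num 1 lab0, mulG (num 1 st0) (pwW1 tm ℓ 1), mulG (inputStackG tm cfalse ctrue) (pwW1 tm ℓ (kin + 2))]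

variable {tm ℓ cfalse ctrue lab0 st0 kin}

/-- `bitG` is good. [folklore] -/
theorem good_bitG : (bitG tm).Good := (good_parityG.substArgs _).substLast (good_mspG.substArgs _)

/-- `inDigitG` is good. [folklore] -/
theorem good_inDigitG : (inDigitG tm cfalse ctrue).Good :=
  good_select good_bitG (by
    intro p hp
    simp only [List.mem_cons, List.not_mem_nil, or_false] at hp
    rcases hp with rfl | rfl <;> exact good_num _ _) (good_num _ _) (by simp)

/-- `inputStackG` is good. [folklore] -/
theorem good_inputStackG : (inputStackG tm cfalse ctrue).Good := good_collect good_inDigitG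

/-- `pwW1` is good. [folklore] -/
theorem good_pwW1 (i : ℕ) : (pwW1 tm ℓ i).Good := good_pwG.substArgs _

/-- **`initG` is good.** [cite: Krajicek1995, Lemma 6.1.1 (p. 86)] -/
theorem good_initG : (initG tm ℓ cfalse ctrue lab0 st0 kin).Good := by
  refine good_sumG fun F hF => ?_
  simp only [List.mem_cons, List.not_mem_nil, or_false] at hF
  rcases hF with rfl | rfl | rfl
  · exact good_num _ _
  · exact (good_num _ _).mulG (good_pwW1 _)
  · exact good_inputStackG.mulG (good_pwW1 _)

end Init

/-! ## The output (context `(x, c)` and `(x, c, i)`) -/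

section Out

variable (tm : FinTM2) (ℓ : Language.boundedArith.Term (Fin 1)) (kout cout : ℕ)

/-- Digit `i` of the output stack field `kout + 2` of the final code `c`, on `(x, c, i)`:
`blk(S, blk(S, c, kout+2, W), i, b)`. [cite: Krajicek1995, §6.1 (p. 86)] -/
noncomputable def outSymG : GDef 3 :=
  substLast
    (substArgs ![(S3 tm ℓ).relabel Fin.castSucc, Term.var 3, Term.var 2, natConst (symWidth tm)] blkG)
    (substArgs ![S3 tm ℓ, Term.var 1, natConst (kout + 2), W3 tm ℓ] blkG)

/-- **The output bit** `i`: `1` if digit `i` of the output stack is the code `cout` of the output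
symbol `true`, else `0`. [cite: Krajicek1995, §6.1 (p. 86)] -/
noncomputable def outDigitG : GDef 3 := select (outSymG tm ℓ kout) [(cout, num 3 1)] (num 3 0)

/-- **The output** read off the final code: the number whose bits are the output bits (a
comprehension of width `1` over `|ω(x)|` positions), or `0` when the output symbol `true` cannot
occur (`cout = 0`). [cite: Krajicek1995, §6.1 (p. 86)] -/
noncomputable def outG : GDef 2 :=
  if cout = 0 then num 2 0
  else collect (outDigitG tm ℓ kout cout) ((widthTerm tm ℓ).relabel ![0]) (natConst 1)

variable {tm ℓ kout cout}

/-- `outSymG` is good. [folklore] -/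
theorem good_outSymG : (outSymG tm ℓ kout).Good := (good_blkG.substArgs _).substLast (good_blkG.substArgs _)

/-- `outDigitG` is good. [folklore] -/
theorem good_outDigitG : (outDigitG tm ℓ kout cout).Good :=
  good_select good_outSymG (by
    intro p hp
    simp only [List.mem_cons, List.not_mem_nil, or_false] at hp
    rcases hp with rfl; exact good_num _ _) (good_num _ _) (by simp)

/-- **`outG` is good.** [cite: Krajicek1995, Lemma 6.1.1 (p. 86)] -/
theorem good_outG : (outG tm ℓ kout cout).Good := by
  unfold outG
  split_ifs
  · exact good_num _ _
  · exact good_collect good_outDigitG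

end Out

/-! ## The whole computation -/

section Machine

variable (tm : FinTM2) (ℓ : Language.boundedArith.Term (Fin 1)) (cfalse ctrue lab0 st0 kin kout cout : ℕ)

/-- **The function computed by the machine, as a uniform `Σᵇ₁` definition**: the output read off
the `|ℓ(x)|`-th iterate of the step from the initial configuration (Krajíček 1995, Lemma 6.1.1;
Buss 1986, Ch. 3). [cite: Krajicek1995, Lemma 6.1.1 (p. 86)] -/
noncomputable def machineG : GDef 1 :=
  substLast (outG tm ℓ kout cout)
    (iterate (initG tm ℓ cfalse ctrue lab0 st0 kin) (stepG tm ℓ) ℓ (blockTerm tm ℓ))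

/-- **`machineG` is good**: its graph is a `Σᵇ₁` formula defining a total function in every model
of `BASIC + Σᵇ₁-PIND`. [cite: Krajicek1995, Lemma 6.1.1 (p. 86)] -/
theorem good_machineG : (machineG tm ℓ cfalse ctrue lab0 st0 kin kout cout).Good :=
  good_outG.substLast (good_iterate good_initG good_stepG)

end Machine

end S2Machine

end Literature.Computability.Complexity
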